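import Summits.MatrixMultiplication.OmegaCensus.SmallFormats.GF2FastLB
import HarnessLib

/-!
# ω-census family (a), GF(2) rank floors: FAST replay of LP-DFS rounds, part 3 (linear leaf test, list paths, assembly)

Cell `pub-mm22` (MatrixMultiplication venture, Route D3-STRETCH `20 ≤ R_𝔽₂(⟨3,3,3⟩)`, seat p3 g3), topic
`Summits/MatrixMultiplication/OmegaCensus` (sub-folder `SmallFormats`). HONEST FRAMING: checker PLUMBING, PROVED (0 sorry);
no bound is claimed here and nothing is progress on `ω`.

The landed LP-leaf test `lpLeafMB` (`GF2OrbitSweepLP.lean`) indexes rows through `List.get` inside `Finset` sums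
(quadratic in the number of rows), tests bits with `Nat.testBit` (~0.5 ms per call in the kernel) and threads the DFS
path as a function `Fin d → Fin N` built with `Fin.snoc`. This file gives an equivalent test that the kernel evaluates
in one pass per candidate with accelerated primitives only:

* `sumClearR`, `sumYR`, `gainR`, `pathCountL`, `maxL` — single `List.rec` passes with `bitB`; the path is a `List ℕ`;
* `lpLeafL` and `lpLeafMB_of_lpLeafL` (the path list is `List.ofFn (fun p => (s p : ℕ))`);
* `MCert.checkL` — the tree replay on list paths (children enumerated by `allRange` from the path maximum) and
  `MCert.check_of_checkL`;
* `fastRootL` (one root) and the assembly `rootsOKX_dfsLP_of_fastL`: `RootsOKX` of a landed `StepX.dfsLP` from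
  key-sorted tables, a certified value tree (`GF2FastLB.lean`) and every root passing `checkL` with the tree as oracle
  (monotonicity `MCert.check_mono`).
-/

namespace Summit.MatrixMultiplication.OmegaCensus.GF2RankLB

open Literature.Computability.AlgebraicComplexity

/-! ## Single-pass sums -/

section Sums

variable {N : ℕ}

/-- `∑ y_j` over the rows whose mask has bit `nn` clear. -/
noncomputable def sumClearR (rows : List (ℕ × ℕ)) (nn : ℕ) : ℕ :=
  List.rec (motive := fun _ => ℕ) 0 (fun r _ acc => bif bitB r.1 nn then acc else Nat.add r.2 acc) rows

/-- `∑ y_j`. -/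
noncomputable def sumYR (rows : List (ℕ × ℕ)) : ℕ :=
  List.rec (motive := fun _ => ℕ) 0 (fun r _ acc => Nat.add r.2 acc) rows

/-- `#{p ∈ path | bit p of fm}` (with multiplicity). -/
noncomputable def pathCountL (fm : ℕ) (pl : List ℕ) : ℕ :=
  List.rec (motive := fun _ => ℕ) 0 (fun p _ acc => Nat.add (bif bitB fm p then 1 else 0) acc) pl

/-- `∑ y_j · (LB fm_j + #{p ∈ path | bit p of fm_j})`. -/
noncomputable def gainR (LBm : ℕ → ℕ) (pl : List ℕ) (rows : List (ℕ × ℕ)) : ℕ :=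
  List.rec (motive := fun _ => ℕ) 0
    (fun r _ acc => Nat.add (Nat.mul r.2 (Nat.add (LBm r.1) (pathCountL r.1 pl))) acc) rows

/-- Maximum of a path list (`0` for the empty path). -/
noncomputable def maxL (pl : List ℕ) : ℕ := List.rec (motive := fun _ => ℕ) 0 (fun p _ acc => max p acc) pl

/-- The sum of a mapped list is the fold over the list. -/
theorem sum_map_eq_foldr {α β : Type*} [AddCommMonoid β] (f : α → β) :
    ∀ l : List α, (l.map f).sum = l.foldr (fun r acc => f r + acc) 0
  | [] => rfl
  | r :: rest => by rw [List.map_cons, List.sum_cons, List.foldr_cons, sum_map_eq_foldr f rest]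

/-- A sum over row indices is the fold over the row list. -/
theorem sum_fin_get_eq_foldr {β : Type*} [AddCommMonoid β] (f : ℕ × ℕ → β) (rows : List (ℕ × ℕ)) :
    ∑ j : Fin rows.length, f (rows.get j) = rows.foldr (fun r acc => f r + acc) 0 := by
  rw [← sum_map_eq_foldr, ← List.ofFn_getElem_eq_map, Fin.sum_ofFn]
  rfl

/-- `sumClearR` as a fold with `Nat.testBit`. -/
theorem sumClearR_eq_foldr (rows : List (ℕ × ℕ)) (nn : ℕ) :
    sumClearR rows nn = rows.foldr (fun r acc => (bif r.1.testBit nn then 0 else r.2) + acc) 0 := by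
  induction rows with
  | nil => rfl
  | cons r rs ih =>
    show (bif bitB r.1 nn then sumClearR rs nn else Nat.add r.2 (sumClearR rs nn)) = _
    rw [List.foldr_cons, ih, bitB_eq_testBit]
    cases r.1.testBit nn <;> simp

/-- `sumClearR` is the filtered sum of `lpLeafMB`. -/
theorem sumClearR_spec (rows : List (ℕ × ℕ)) (nn : ℕ) :
    (∑ j ∈ Finset.univ.filter (fun j : Fin rows.length => (rows.get j).1.testBit nn = false),
      (rows.get j).2) = sumClearR rows nn := by
  rw [Finset.sum_filter, sumClearR_eq_foldr, ← sum_fin_get_eq_foldr (fun r => bif r.1.testBit nn then 0 else r.2) rows]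
  refine Finset.sum_congr rfl fun j _ => ?_
  cases (rows.get j).1.testBit nn <;> simp

/-- `sumYR` is the plain sum. -/
theorem sumYR_spec (rows : List (ℕ × ℕ)) : (∑ j : Fin rows.length, (rows.get j).2) = sumYR rows := by
  rw [sum_fin_get_eq_foldr (fun r => r.2) rows]
  induction rows with
  | nil => rfl
  | cons r rs ih =>
    show _ = Nat.add r.2 (sumYR rs)
    rw [List.foldr_cons, ih]
    rfl

/-- `pathCountL` as the sum of a mapped list. -/
theorem pathCountL_eq_sum (fm : ℕ) :
    ∀ pl : List ℕ, pathCountL fm pl = (pl.map fun q => if fm.testBit q = true then 1 else 0).sum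
  | [] => rfl
  | p :: ps => by
    show Nat.add (bif bitB fm p then 1 else 0) (pathCountL fm ps) = _
    rw [pathCountL_eq_sum fm ps, List.map_cons, List.sum_cons, bitB_eq_testBit]
    cases fm.testBit p <;> simp

/-- `pathCountL` on the value list of a path `s` is the count of `lpLeafMB`. -/
theorem pathCountL_spec {d : ℕ} (fm : ℕ) (s : Fin d → Fin N) :
    pathCountL fm (List.ofFn fun p => (s p : ℕ)) =
      (Finset.univ.filter fun p : Fin d => fm.testBit (s p) = true).card := by
  rw [Finset.card_filter, pathCountL_eq_sum, List.map_ofFn, Fin.sum_ofFn]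
  rfl

/-- `gainR` as a fold. -/
theorem gainR_eq_foldr (LBm : ℕ → ℕ) (pl : List ℕ) (rows : List (ℕ × ℕ)) :
    gainR LBm pl rows = rows.foldr (fun r acc => r.2 * (LBm r.1 + pathCountL r.1 pl) + acc) 0 := by
  induction rows with
  | nil => rfl
  | cons r rs ih =>
    show Nat.add (Nat.mul r.2 (Nat.add (LBm r.1) (pathCountL r.1 pl))) (gainR LBm pl rs) = _
    rw [List.foldr_cons, ih]
    rfl

/-- `gainR` on the value list of a path is the weighted sum of `lpLeafMB`. -/
theorem gainR_spec (LBm : ℕ → ℕ) {d : ℕ} (s : Fin d → Fin N) (rows : List (ℕ × ℕ)) :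
    (∑ j : Fin rows.length, (rows.get j).2 * (LBm (rows.get j).1 +
      (Finset.univ.filter fun p : Fin d => (rows.get j).1.testBit (s p) = true).card)) =
      gainR LBm (List.ofFn fun p => (s p : ℕ)) rows := by
  rw [gainR_eq_foldr, sum_fin_get_eq_foldr (fun r => r.2 * (LBm r.1 +
    (Finset.univ.filter fun p : Fin d => r.1.testBit (s p) = true).card)) rows]
  simp only [pathCountL_spec]

/-- `maxL` is below any common bound. -/
theorem maxL_le : ∀ (pl : List ℕ) (n : ℕ), (∀ x ∈ pl, x ≤ n) → maxL pl ≤ n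
  | [], n, _ => Nat.zero_le n
  | p :: ps, n, h => by
    show max p (maxL ps) ≤ n
    exact max_le (h p List.mem_cons_self) (maxL_le ps n fun x hx => h x (List.mem_cons_of_mem p hx))

/-- A candidate above the whole path is above the path maximum. -/
theorem maxL_ofFn_le {d : ℕ} (s : Fin d → Fin N) (nn : Fin N) (h : ∀ p : Fin d, s p ≤ nn) :
    maxL (List.ofFn fun p => (s p : ℕ)) ≤ nn := by
  refine maxL_le _ _ fun x hx => ?_
  obtain ⟨p, rfl⟩ := List.mem_ofFn.1 hx
  exact h p

end Sums

/-! ## The leaf test on list paths -/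

section Leaf

variable {N : ℕ}

/-- FAST LP-leaf test on a list path: dual feasibility for the candidates from the path maximum on (one pass per
candidate), and the closing inequality (one pass). Same content as `lpLeafMB`. -/
noncomputable def lpLeafL (N : ℕ) (LBm : ℕ → ℕ) (target : ℕ) (rows : List (ℕ × ℕ)) (D d : ℕ) (pl : List ℕ) :
    Bool :=
  allRange (fun nn => Nat.ble (sumClearR rows nn) D) (maxL pl) (N - maxL pl) &&
    Nat.blt ((target - 1) * D + d * sumYR rows) (gainR LBm pl rows + D * d)

/-- **The fast leaf test implies the landed one.** -/
theorem lpLeafMB_of_lpLeafL {LBm : ℕ → ℕ} {target : ℕ} {rows : List (ℕ × ℕ)} {D d : ℕ} {s : Fin d → Fin N}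
    (h : lpLeafL N LBm target rows D d (List.ofFn fun p => (s p : ℕ)) = true) :
    lpLeafMB LBm target rows D d s = true := by
  unfold lpLeafL at h
  rw [Bool.and_eq_true, Nat.blt_eq] at h
  obtain ⟨h1, h2⟩ := h
  simp only [lpLeafMB, Bool.and_eq_true, decide_eq_true_eq]
  refine ⟨fun nn hnn => ?_, ?_⟩
  · have hlo := maxL_ofFn_le s nn hnn
    have h3 := allRange_spec _ _ _ h1 nn hlo (by have := nn.2; omega)
    rw [Nat.ble_eq] at h3
    rwa [sumClearR_spec]
  · rwa [sumYR_spec, gainR_spec]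

end Leaf

/-! ## The tree replay on list paths -/

section Tree

variable {N : ℕ}

/-- FAST tree replay: `lpLeafL` at the leaves; at a node of depth `d` with path `pl`, `d < maxDepth` and every
child from the path maximum on passes with the extended path. -/
noncomputable def MCert.checkL (LBm : ℕ → ℕ) (target maxDepth : ℕ) : MCert N → ℕ → List ℕ → Bool
  | .leaf rows D, d, pl => lpLeafL N LBm target rows D d pl
  | .node cs, d, pl => Nat.blt d maxDepth &&
      allRange (fun m => if hm : m < N then (cs ⟨m, hm⟩).checkL LBm target maxDepth (d + 1) (pl ++ [m]) else true)
        (maxL pl) (N - maxL pl)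

/-- Extending a path by `Fin.snoc` appends to its value list. -/
theorem ofFn_snoc_val {d : ℕ} (s : Fin d → Fin N) (m : Fin N) :
    (List.ofFn fun p : Fin (d + 1) => ((Fin.snoc s m : Fin (d + 1) → Fin N) p : ℕ)) =
      (List.ofFn fun p => (s p : ℕ)) ++ [(m : ℕ)] := by
  rw [List.ofFn_succ', List.concat_eq_append]
  simp

/-- **The fast tree replay implies the landed one.** -/
theorem MCert.check_of_checkL {LBm : ℕ → ℕ} {target maxDepth : ℕ} :
    ∀ (t : MCert N) (d : ℕ) (s : Fin d → Fin N),
      t.checkL LBm target maxDepth d (List.ofFn fun p => (s p : ℕ)) = true →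
        t.check LBm target maxDepth d s = true
  | .leaf rows D, d, s, h => by
    simp only [MCert.check, MCert.checkL] at h ⊢
    exact lpLeafMB_of_lpLeafL h
  | .node cs, d, s, h => by
    simp only [MCert.checkL, Bool.and_eq_true, Nat.blt_eq] at h
    obtain ⟨hd, hall⟩ := h
    simp only [MCert.check, Bool.and_eq_true, decide_eq_true_eq]
    refine ⟨hd, fun m hm => ?_⟩
    have hlo := maxL_ofFn_le s m hm
    have h1 := allRange_spec _ _ _ hall m hlo (by have := m.2; omega)
    rw [dif_pos m.2, ← ofFn_snoc_val] at h1
    exact MCert.check_of_checkL (cs m) (d + 1) (Fin.snoc s m) h1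

/-- The `k`-th root of a family passes the fast replay (vacuous out of range). -/
noncomputable def fastRootL (roots : Fin N → MCert N) (LBm : ℕ → ℕ) (target k : ℕ) : Bool :=
  if h : k < N then (roots ⟨k, h⟩).checkL LBm target (target - 1) 1 [k] else true

/-- Unfolding `fastRootL` at a named root (the data files name every root tree). -/
theorem fastRootL_eq (roots : Fin N → MCert N) (LBm : ℕ → ℕ) (target k : ℕ) (hk : k < N) (t : MCert N)
    (ht : roots ⟨k, hk⟩ = t) : fastRootL roots LBm target k = t.checkL LBm target (target - 1) 1 [k] := by
  unfold fastRootL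
  rw [dif_pos hk, ht]

end Tree

/-! ## Assembly: `RootsOKX` of an LP-DFS round from the fast facts -/

/-- **`RootsOKX` of an LP-DFS round** from: key-sorted tables, a value tree whose nodes pass `hintOK`, and every root
passing the fast replay with the value tree as oracle. -/
theorem rootsOKX_dfsLP_of_fastL (os : List OrbitX) {cands : List ℕ} {target x b c : ℕ}
    {tb tt : List LookRow} {roots : Fin cands.length → MCert cands.length} (vt : VTree)
    (hb : keysAscB tb = true) (ht : keysAscB tt = true)
    (hvt : vt.allB (hintOK (coreOf os) tb tt cands.length) = true)
    (h : ∀ k < cands.length, fastRootL roots vt.find target k = true) :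
    RootsOKX os (.dfsLP cands target x b c tb tt roots) := by
  intro mm
  have hle : ∀ fm, vt.find fm ≤ lbOf2 (coreOf os) tb tt (setOf cands.length fm) :=
    VTree.find_le (fun _ _ _ hk => le_lbOf2_of_hintOK (coreOf os) hb ht hk) vt hvt
  have h1 := h mm.1 mm.2
  unfold fastRootL at h1
  rw [dif_pos mm.2] at h1
  refine MCert.check_mono hle _ _ _ (MCert.check_of_checkL _ _ _ ?_)
  exact h1

end Summit.MatrixMultiplication.OmegaCensus.GF2RankLB
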